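import Mathlib
import Summits.KontsevichZagierPeriods.Zeta5Search.Families.BasicGrowth
import HarnessLib

/-!
# ζ(5) search — Families: combinatorial bounds for the growth constant — `1/∏_e |span e| ≤ M_σ ≤ 1/2`

HONEST FRAMING: systematic search; no irrationality claim unless certified.  STRUCTURAL facts about Brown's basic
cellular integrals `I_σ(N) = ∫_{S_n} f_σ^N ω_σ` [Brown2016, §1.5 (1.3)–(1.4)] (seat P2, Families layer); nothing
about the arithmetic of any zeta value.

`Families/BasicGrowth.lean` proved `I_σ(N)^{1/N} → M_σ = sup_S f_σ` for every convergent bijective seating `σ` of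
`n = ℓ + 3` points.  Here `M_σ` is bounded on both sides by COMBINATORIAL quantities of the seating:
* `two_le_card_span` — for a CONVERGENT `σ` (`n ≥ 4`) EVERY finite `σδ⁰`-edge `{z_{σ_i}, z_{σ_{i+1}}}` spans at
  least two gaps of the simplex (Brown's condition with `k = 2`: neighbours never sit together; this extends
  `exists_sEdge_two_le_card_span` of `Families/BasicLimit.lean` from one edge to all);
* **`fSigma_le_half`** — hence **`f_σ ≤ 1/2` on the open simplex**: in the Hall matching `e` of edges to gaps
  (`exists_gap_equiv`, `f_σ = ∏_i gap(e i)/len(i)`), the edge matched to a SMALLEST gap has length at least twice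
  that gap; so `M_σ ≤ 1/2 < 1` (`fSup_le_half`, `fSup_lt_one`) and **`I_σ(N) ≤ 2^{−N} · I_σ(0)`**
  (`integral_basic_le_half_pow`): the basic cellular integrals of every convergent configuration decay (at least)
  exponentially — `Families/BasicLimit.lean` had `I_σ(N) → 0` without a rate;
* `inv_prod_card_span_le_fSup` — evaluating `f_σ` at the barycentre (all gaps equal to `1/(ℓ+1)`, where every
  edge length is `|span|/(ℓ+1)`) gives the lower bound **`M_σ ≥ 1 / ∏_i |span(i)|`** over the finite `σδ⁰`-edges.
(For Brown's `N = 5` example these read `1/12 ≤ ((√5−1)/2)^5 ≤ 1/2`.)  Standard axioms only.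
-/

noncomputable section

open MeasureTheory Set Finset Filter Topology

namespace Summit.KontsevichZagierPeriods.Zeta5Search.Families.Cellular

variable {ℓ : ℕ} (σ : Fin (ℓ + 3) → Fin (ℓ + 3))

/-! ### Every finite edge of a convergent seating is long -/

/-- For a CONVERGENT bijective seating on `n = ℓ + 3 ≥ 4` points, every finite `σδ⁰`-edge
`{z_{σ_p}, z_{σ_{p+1}}}` spans at least two gaps: otherwise the window `{p, p+1}` would be seated into the block
`{σ_p, σ_p ± 1}`, against Brown's condition with `k = 2`. [Brown2016, §1.5] -/
theorem two_le_card_span (hσ : Function.Bijective σ) (hc : Convergent σ) (hℓ : 1 ≤ ℓ) (i0 : SEdge σ) :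
    2 ≤ ((cellEdges σ hσ.1).span (Sum.inr i0)).card := by
  -- adapted from `exists_sEdge_two_le_card_span` (Families/BasicLimit.lean), for an arbitrary finite edge
  classical
  obtain ⟨p, hp⟩ := i0
  by_contra hlt
  rw [not_le] at hlt
  set E := cellEdges σ hσ.1 with hE
  have hlo : E.lo (Sum.inr ⟨p, hp⟩) = min (σ p).val (σ (p + 1)).val := rfl
  have hhi : E.hi (Sum.inr ⟨p, hp⟩) = max (σ p).val (σ (p + 1)).val := rfl
  have hlh := E.lo_lt_hi (Sum.inr ⟨p, hp⟩)
  have hhi' := E.hi_le (Sum.inr ⟨p, hp⟩)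
  have hsucc : E.hi (Sum.inr ⟨p, hp⟩) = E.lo (Sum.inr ⟨p, hp⟩) + 1 := by
    by_contra hne
    have htwo : E.lo (Sum.inr ⟨p, hp⟩) + 2 ≤ E.hi (Sum.inr ⟨p, hp⟩) := by omega
    apply (lt_irrefl 1 : ¬ (1 : ℕ) < 1)
    calc (1 : ℕ) < (E.span (Sum.inr ⟨p, hp⟩)).card := by
          rw [Finset.one_lt_card_iff]
          refine ⟨⟨E.lo (Sum.inr ⟨p, hp⟩), by omega⟩, ⟨E.lo (Sum.inr ⟨p, hp⟩) + 1, by omega⟩, ?_, ?_, ?_⟩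
          · rw [EdgeFamily.mem_span]; simp only; omega
          · rw [EdgeFamily.mem_span]; simp only; omega
          · intro h; have := congrArg Fin.val h; simp only at this; omega
      _ ≤ 1 := by omega
  -- hence the window `{p, p+1}` is seated into a block of two consecutive places
  apply hc p 2 (by omega) le_rfl
  have harc : ∀ v : Fin (ℓ + 3), v ∈ arc p 2 → v = p ∨ v = p + 1 := by
    intro v hv
    rw [mem_arc] at hv
    rcases Nat.lt_or_ge ((v - p : Fin (ℓ + 3)) : ℕ) 1 with h | h
    · left
      have : (v - p : Fin (ℓ + 3)) = 0 := Fin.ext (by rw [Fin.val_zero]; omega)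
      rwa [sub_eq_zero] at this
    · right
      have : (v - p : Fin (ℓ + 3)) = 1 := Fin.ext (by rw [Fin.val_one]; omega)
      rw [sub_eq_iff_eq_add] at this
      exact this.trans (add_comm _ _)
  have hmem : ∀ a x : Fin (ℓ + 3), (x = a ∨ x.val = a.val + 1) → x ∈ arc a 2 := by
    rintro a x (h | h)
    · rw [mem_arc, h, sub_self, Fin.val_zero]; norm_num
    · rw [mem_arc, Fin.sub_val_of_le (Fin.le_iff_val_le_val.2 (by omega)), h]; norm_num
  rcases le_total (σ p).val (σ (p + 1)).val with hle | hle
  · rw [min_eq_left hle] at hlo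
    rw [max_eq_right hle] at hhi
    refine ⟨σ p, fun v hv => ?_⟩
    rcases harc v hv with h | h
    · exact hmem _ _ (Or.inl (by rw [h]))
    · exact hmem _ _ (Or.inr (by rw [h]; omega))
  · rw [min_eq_right hle] at hlo
    rw [max_eq_left hle] at hhi
    refine ⟨σ (p + 1), fun v hv => ?_⟩
    rcases harc v hv with h | h
    · exact hmem _ _ (Or.inr (by rw [h]; omega))
    · exact hmem _ _ (Or.inl (by rw [h]))

/-! ### `f_σ ≤ 1/2` -/

/-- **`f_σ ≤ 1/2` on the open simplex**, for every convergent bijective seating on `n ≥ 4` points: match the finite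
`σδ⁰`-edges bijectively to gaps inside their spans (`exists_gap_equiv`); the edge matched to a smallest gap spans a
second gap at least as long, so its factor `gap/len` is `≤ 1/2`, all other factors being `≤ 1`. -/
theorem fSigma_le_half (hσ : Function.Bijective σ) (hc : Convergent σ) (hℓ : 1 ≤ ℓ) {t : Fin ℓ → ℝ}
    (ht : t ∈ openSimplex ℓ) : fSigma σ t ≤ 1 / 2 := by
  classical
  obtain ⟨e, hspan⟩ := exists_gap_equiv σ hσ
  have hpos := (mem_openSimplex_iff_gapN t).1 ht
  have hden : 0 < formDen σ t := Finset.prod_pos fun i _ => ef_pos ht fun h => succ_ne_self i (hσ.1 h)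
  -- a smallest gap `w0`, matched to the edge `i1`
  obtain ⟨w0, -, hw0⟩ := Finset.exists_min_image Finset.univ (fun w : Fin (ℓ + 1) => gapN t w) Finset.univ_nonempty
  set i1 : SEdge σ := e.symm w0 with hi1
  have hei1 : e i1 = w0 := by rw [hi1, Equiv.apply_symm_apply]
  have hle : ∀ i : SEdge σ, gapN t (e i) ≤ (cellEdges σ hσ.1).len t (Sum.inr i) := by
    intro i
    rw [(cellEdges σ hσ.1).len_eq_sum_gap]
    exact Finset.single_le_sum (fun w _ => (hpos w).le) (hspan i)
  have hkey : 2 * gapN t (e i1) ≤ (cellEdges σ hσ.1).len t (Sum.inr i1) := by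
    rw [(cellEdges σ hσ.1).len_eq_sum_gap]
    obtain ⟨w, hw, hwne⟩ := Finset.exists_mem_ne (two_le_card_span σ hσ hc hℓ i1) (e i1)
    have hmin : gapN t (e i1) ≤ gapN t w := by rw [hei1]; exact hw0 w (Finset.mem_univ _)
    have hpair : ({e i1, w} : Finset (Fin (ℓ + 1))) ⊆ (cellEdges σ hσ.1).span (Sum.inr i1) := by
      intro x hx
      rw [Finset.mem_insert, Finset.mem_singleton] at hx
      rcases hx with rfl | rfl
      · exact hspan i1
      · exact hw
    have h2 : ∑ x ∈ ({e i1, w} : Finset (Fin (ℓ + 1))), gapN t x ≤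
        ∑ x ∈ (cellEdges σ hσ.1).span (Sum.inr i1), gapN t x :=
      Finset.sum_le_sum_of_subset_of_nonneg hpair fun x _ _ => (hpos x).le
    rw [Finset.sum_pair hwne.symm] at h2
    linarith
  unfold fSigma
  rw [div_le_iff₀ hden, prod_ef_succ_eq_prod_gapN, formDen_eq_prod_len σ hσ ht, ← Equiv.prod_comp e,
    ← Finset.mul_prod_erase Finset.univ _ (Finset.mem_univ i1),
    ← Finset.mul_prod_erase Finset.univ (fun i => (cellEdges σ hσ.1).len t (Sum.inr i)) (Finset.mem_univ i1)]
  have hrest : ∏ i ∈ Finset.univ.erase i1, gapN t (e i) ≤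
      ∏ i ∈ Finset.univ.erase i1, (cellEdges σ hσ.1).len t (Sum.inr i) :=
    Finset.prod_le_prod (fun i _ => (hpos _).le) fun i _ => hle i
  have hrest0 : 0 ≤ ∏ i ∈ Finset.univ.erase i1, gapN t (e i) := Finset.prod_nonneg fun i _ => (hpos _).le
  have hlen0 : 0 ≤ (cellEdges σ hσ.1).len t (Sum.inr i1) := ((cellEdges σ hσ.1).len_pos ht _).le
  calc gapN t (e i1) * ∏ i ∈ Finset.univ.erase i1, gapN t (e i)
      ≤ (1 / 2 * (cellEdges σ hσ.1).len t (Sum.inr i1)) *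
          ∏ i ∈ Finset.univ.erase i1, (cellEdges σ hσ.1).len t (Sum.inr i) :=
        mul_le_mul (by linarith) hrest hrest0 (by linarith)
    _ = 1 / 2 * ((cellEdges σ hσ.1).len t (Sum.inr i1) *
          ∏ i ∈ Finset.univ.erase i1, (cellEdges σ hσ.1).len t (Sum.inr i)) := by ring

/-- **`M_σ ≤ 1/2`** for every convergent bijective seating on `n ≥ 4` points. -/
theorem fSup_le_half (hσ : Function.Bijective σ) (hc : Convergent σ) (hℓ : 1 ≤ ℓ) : fSup σ ≤ 1 / 2 :=
  fSup_le_of_forall_le σ fun _ ht => fSigma_le_half σ hσ hc hℓ ht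

/-- `M_σ < 1` for every convergent bijective seating on `n ≥ 4` points (genuine exponential decay). -/
theorem fSup_lt_one (hσ : Function.Bijective σ) (hc : Convergent σ) (hℓ : 1 ≤ ℓ) : fSup σ < 1 := by
  have := fSup_le_half σ hσ hc hℓ
  linarith

/-- **Exponential decay of the basic cellular integrals**: `I_σ(N) ≤ 2^{−N} · I_σ(0)` for every convergent bijective
seating on `n ≥ 4` points and every `N ∈ ℕ`. [Brown2016, §1.5 objects; structural] -/
theorem integral_basic_le_half_pow (hσ : Function.Bijective σ) (hc : Convergent σ) (hℓ : 1 ≤ ℓ) (N : ℕ) :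
    integral σ (fun _ => (N : ℤ)) (fun _ => (N : ℤ)) ≤
      (1 / 2) ^ N * integral σ (fun _ => (0 : ℤ)) (fun _ => (0 : ℤ)) :=
  (integral_basic_le_fSup_pow σ hσ N).trans (mul_le_mul_of_nonneg_right
    (pow_le_pow_left₀ (fSup_pos σ hσ).le (fSup_le_half σ hσ hc hℓ) N) (integral_nonneg hσ.1 _ _))

/-- Pointwise form of the decay: `f_σ^N ω_σ ≤ 2^{−N} ω_σ` on the open simplex. -/
theorem basic_le_half_pow_mul (hσ : Function.Bijective σ) (hc : Convergent σ) (hℓ : 1 ≤ ℓ) (N : ℕ)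
    {t : Fin ℓ → ℝ} (ht : t ∈ openSimplex ℓ) : basic σ (N : ℤ) t ≤ (1 / 2) ^ N * basic σ 0 t := by
  rw [basic_natCast_eq]
  exact mul_le_mul_of_nonneg_right (pow_le_pow_left₀ (fSigma_pos σ hσ.1 ht).le (fSigma_le_half σ hσ hc hℓ ht) N)
    (integrand_pos hσ.1 _ _ ht).le

/-! ### The barycentre and the lower bound `M_σ ≥ 1/∏ |span|` -/

/-- The marked points at the barycentre `t_j = (j+1)/(ℓ+1)` of the simplex: `pt k = k/(ℓ+1)` for `k ≤ ℓ + 1`. -/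
theorem pt_barycenter {k : ℕ} (hk : k ≤ ℓ + 1) :
    pt (fun j : Fin ℓ => ((j : ℕ) + 1 : ℝ) / (ℓ + 1)) k = (k : ℝ) / (ℓ + 1) := by
  unfold pt
  split_ifs with h0 h1
  · rw [h0, Nat.cast_zero, zero_div]
  · simp only
    rw [show (((k - 1 : ℕ) : ℝ) + 1) = (k : ℝ) by
      rw [show k = (k - 1) + 1 from (Nat.succ_pred_eq_of_pos (Nat.pos_of_ne_zero h0)).symm]
      push_cast
      simp]
  · have hk' : k = ℓ + 1 := by omega
    subst hk'
    rw [eq_comm, div_eq_one_iff_eq (by positivity)]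
    push_cast
    ring

/-- At the barycentre every gap equals `1/(ℓ+1)`. -/
theorem gapN_barycenter (w : Fin (ℓ + 1)) :
    gapN (fun j : Fin ℓ => ((j : ℕ) + 1 : ℝ) / (ℓ + 1)) w = 1 / (ℓ + 1) := by
  unfold gapN
  rw [pt_barycenter (by omega), pt_barycenter (by omega)]
  push_cast
  ring

/-- The barycentre lies in the open simplex. -/
theorem barycenter_mem_openSimplex : (fun j : Fin ℓ => ((j : ℕ) + 1 : ℝ) / (ℓ + 1)) ∈ openSimplex ℓ :=
  (mem_openSimplex_iff_gapN _).2 fun w => by rw [gapN_barycenter]; positivity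

/-- At the barycentre the length of an edge is `|span| / (ℓ+1)`. -/
theorem len_barycenter {ι : Type*} (E : EdgeFamily ℓ ι) (i : ι) :
    E.len (fun j : Fin ℓ => ((j : ℕ) + 1 : ℝ) / (ℓ + 1)) i = ((E.span i).card : ℝ) / (ℓ + 1) := by
  rw [E.len_eq_sum_gap, Finset.sum_congr rfl fun w _ => gapN_barycenter w, Finset.sum_const, nsmul_eq_mul]
  ring

/-- **`f_σ` at the barycentre is `1 / ∏_i |span(i)|`** (product over the finite `σδ⁰`-edges). -/
theorem fSigma_barycenter (hσ : Function.Bijective σ) :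
    fSigma σ (fun j : Fin ℓ => ((j : ℕ) + 1 : ℝ) / (ℓ + 1)) =
      1 / ∏ i : SEdge σ, (((cellEdges σ hσ.1).span (Sum.inr i)).card : ℝ) := by
  classical
  unfold fSigma
  rw [prod_ef_succ_eq_prod_gapN, formDen_eq_prod_len σ hσ barycenter_mem_openSimplex,
    Finset.prod_congr rfl fun w _ => gapN_barycenter (ℓ := ℓ) w,
    Finset.prod_congr rfl fun i _ => len_barycenter (cellEdges σ hσ.1) (Sum.inr i),
    Finset.prod_const, Finset.prod_div_distrib, Finset.prod_const, Finset.card_univ, Finset.card_univ,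
    Fintype.card_fin, card_sEdge σ hσ]
  have hne : ((ℓ : ℝ) + 1) ^ (ℓ + 1) ≠ 0 := by positivity
  rw [div_div_eq_mul_div, one_div_pow, one_div_mul_cancel hne]

/-- **Lower bound for the growth constant**: `1 / ∏_i |span(i)| ≤ M_σ` (finite `σδ⁰`-edges), for every bijective
seating. -/
theorem inv_prod_card_span_le_fSup (hσ : Function.Bijective σ) :
    1 / ∏ i : SEdge σ, (((cellEdges σ hσ.1).span (Sum.inr i)).card : ℝ) ≤ fSup σ := by
  rw [← fSigma_barycenter σ hσ]
  exact fSigma_le_fSup σ hσ barycenter_mem_openSimplex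

/-- In particular `2^{−(ℓ+1)·?}`-free form: since every span has at most `ℓ + 1` gaps, `M_σ ≥ (ℓ+1)^{−(ℓ+1)}`. -/
theorem inv_pow_le_fSup (hσ : Function.Bijective σ) : 1 / ((ℓ : ℝ) + 1) ^ (ℓ + 1) ≤ fSup σ := by
  classical
  refine le_trans ?_ (inv_prod_card_span_le_fSup σ hσ)
  have hcard : ∀ i : SEdge σ, (((cellEdges σ hσ.1).span (Sum.inr i)).card : ℝ) ≤ (ℓ : ℝ) + 1 := by
    intro i
    have : ((cellEdges σ hσ.1).span (Sum.inr i)).card ≤ ℓ + 1 :=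
      (Finset.card_le_univ _).trans (by rw [Fintype.card_fin])
    exact_mod_cast this
  have hprod : ∏ i : SEdge σ, (((cellEdges σ hσ.1).span (Sum.inr i)).card : ℝ) ≤ ((ℓ : ℝ) + 1) ^ (ℓ + 1) := by
    calc ∏ i : SEdge σ, (((cellEdges σ hσ.1).span (Sum.inr i)).card : ℝ)
        ≤ ∏ _i : SEdge σ, ((ℓ : ℝ) + 1) := Finset.prod_le_prod (fun i _ => Nat.cast_nonneg _) fun i _ => hcard i
      _ = ((ℓ : ℝ) + 1) ^ (ℓ + 1) := by rw [Finset.prod_const, Finset.card_univ, card_sEdge σ hσ]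
  have hpos : (0 : ℝ) < ∏ i : SEdge σ, (((cellEdges σ hσ.1).span (Sum.inr i)).card : ℝ) :=
    Finset.prod_pos fun i _ => Nat.cast_pos.2 ((cellEdges σ hσ.1).span_nonempty (Sum.inr i)).card_pos
  exact one_div_le_one_div_of_le hpos hprod

end Summit.KontsevichZagierPeriods.Zeta5Search.Families.Cellular
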